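import Literature.Analysis.FunctionSpaces.TorusImprovedHolder
import Literature.Analysis.FluidPDE.ZerothLawProofs
import HarnessLib

/-!
# Nested products of rescaled cutoffs on the flat torus:
# `∫ φ(M₀x) φ(M₁x) ⋯ φ(M_kx) dx ≤ θ^k` (Coiculescu–Palasek 2025, Lemma 3.3)

Analysis/FluidPDE support file (everything proved; no definitions, no named facts) on the
discharge path of the named fact
`Literature.Barriers.NavierStokesRegularity.CoiculescuPalasek2025_principalParts`
(`Barriers/NavierStokesRegularity/CriticalDataSmoothNonuniquenessConstruction.lean`). In
M. P. Coiculescu, S. Palasek, *Non-uniqueness of smooth solutions of the Navier–Stokes equations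
from critical data*, Invent. Math. 244 (2025), arXiv:2503.14699, the supports of the Mikado
potentials of scale `k` lie in the region `Ω̃_k ⊂ ⋂_{m ≤ k} ⋃_j Ω̃_{j,m}` where the pipes of all
coarser scales intersect, and **Lemma 3.3** (`|Ω̃_k| ≤ 2^{-k}|𝕋³|`) is deduced from the
"stronger claim" (display (claim) of its proof)

  `‖φ₀ φ₁ ⋯ φ_k‖_{L¹} ≤ (8δ)^k |𝕋³|`,  `φ_k(x) = φ(M_k x)`,

for one fixed cutoff `φ ∈ C^∞(𝕋³; [0,1])` with `‖φ‖_{L¹} ≤ 4δ` and `|∇φ| ≤ C'δ₀⁻¹`, by induction on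
`k` with the improved Hölder inequality (their Lemma A.2 = Modena–Székelyhidi 2018, Lemma 2.1,
the tree's `Torus.lintegral_rpow_smul_le_of_latticeInvariant`) applied to `f = φ₀⋯φ_{k-1}`,
`g = φ`, `λ = M_k`:
`‖φ₀⋯φ_k‖_{L¹} ≤ ‖φ₀⋯φ_{k-1}‖_{L¹}‖φ‖_{L¹} + O(M_k⁻¹ ‖φ₀⋯φ_{k-1}‖_{C¹} ‖φ‖_{L¹})`, the Lipschitz
constant of the product being at most `∑_{j<k} ‖φ_j‖_{C¹} ≤ C' δ₀⁻¹ ∑_{j<k} M_j`, "so it suffices to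
show `O(C'kM_{k-1}M_k⁻¹) ≤ ½(8δ)^k|𝕋³|`", which holds for the super-exponentially growing scales
`M_k = ⌊A^{b^k}⌋` once `A` is large.

This file proves that induction ABSTRACTLY, on `T^d = UnitAddTorus d` (probability Haar measure,
so `|T^d| = 1`), for an arbitrary cutoff `φ : T^d → [0,1]` whose lift is `L`-Lipschitz, an
arbitrary sequence of positive integer scales `M : ℕ → ℕ`, and a ratio `θ` (the paper's `8δ`):

* `abs_prod_comp_nsmul_sub_le` — the product `P_k = ∏_{j ≤ k} φ(M_j ·)` takes values in `[0,1]`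
  and its lift is `L ∑_{j ≤ k} M_j`-Lipschitz;
* `integral_prod_comp_nsmul_succ_le` — **the inductive step**:
  `∫ P_{k+1} ≤ (∫ P_k + L √d (∑_{j≤k} M_j) / M_{k+1}) ∫ φ` (improved Hölder at `p = 1`, the
  rescaled factor `φ(M_{k+1} ·)` being `(1/M_{k+1})ℤ^d`-invariant with `∫ φ(M_{k+1} ·) = ∫ φ`);
* `integral_prod_comp_nsmul_le_pow` — **the claim**: if `∫ φ ≤ θ/2`, `θ ≤ 2`, and the scales
  satisfy the growth condition `L √d ∑_{j ≤ k} M_j ≤ θ^k M_{k+1}` for every `k` (the paper's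
  "`O(C'kM_{k-1}M_k⁻¹) ≤ ½(8δ)^k`"), then `∫ P_k ≤ θ^k` for all `k`;
* `measureReal_le_pow_of_prod_comp_nsmul_eq_one` — hence every measurable set on which
  `P_k ≡ 1` (in the paper: `𝟙_{Ω̃_k} ≤ φ₀φ₁⋯φ_k`) has measure `≤ θ^k` (Lemma 3.3, first display,
  with `θ = 8δ ≤ 1/2`);
* `sum_range_natCast_le_two_mul_of_lacunary` — for scales with `M_{k+1} ≥ 2M_k` the growth
  condition reduces to `2 L √d M_k ≤ θ^k M_{k+1}`.

The verification of the growth condition for the paper's `M_k` (monotonicity of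
`k ↦ k(8δ)^{-k}M_{k-1}M_k⁻¹` for `A` large) and the geometry of the pipes (`𝟙_{Ω̃_k} ≤ ∏ φ_j`,
the choice of `φ`) are not part of this file. The cube-localised second display of Lemma 3.3
(used only for the `BMO⁻¹` membership of the datum, Prop. 3.8, which the Lean rendering of the
principal parts does not require) is not treated.

## Mathlib / tree search

Reused: `Torus.lintegral_rpow_smul_le_of_latticeInvariant`, `Torus.continuous_of_lipschitz_lift`
(`TorusImprovedHolder`), `Torus.cellCorner` (`TorusLatticeCellTranslation`), `Torus.proj_latticeVec`
(`FlatTorus`), `FluidPDE.proj_natCast_smul`, `FluidPDE.integral_comp_nsmul`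
(`ZerothLawProofs`: Haar invariance of `x ↦ n • x`); Mathlib `Finset.prod_range_succ`,
`MeasureTheory.ofReal_integral_eq_lintegral_ofReal`, `integral_indicator_one`. Nothing on nested /
iterated cutoff products exists (`lean search 'prod_comp_nsmul|nested.*cutoff|phi_0.*phi_1'`).

## References

* M. P. Coiculescu, S. Palasek, Invent. Math. 244 (2025) 165–219, doi:10.1007/s00222-025-01396-z,
  arXiv:2503.14699: Lemma 3.3 and its proof (displays (phiinl1), (claim)), App. A Lemma A.2
  (improved Hölder). [CoiculescuPalasek2025]
* S. Modena, L. Székelyhidi Jr., Ann. PDE 4 (2018), no. 18 = arXiv:1712.03867, Lemma 2.1.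
  [ModenaSzekelyhidi2018]
-/

noncomputable section

open MeasureTheory Set Filter
open scoped ENNReal NNReal BigOperators

namespace Literature.Analysis.FluidPDE

open Literature.Analysis.FunctionSpaces Literature.Analysis.FunctionSpaces.Torus

variable {d : Type*} [Fintype d] [DecidableEq d]

/-! ## Rescaled cutoffs `φ(n • ·)`: Lipschitz constant and invariance under the finer lattice -/

section Rescale

variable {F' : Type*} {φ : UnitAddTorus d → ℝ} {L : ℝ}

omit [DecidableEq d] in
/-- If the lift of `φ` is `L`-Lipschitz then the lift of `φ(n • ·)` is `Ln`-Lipschitz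
(`proj (n y) = n • proj y`). [folklore] -/
theorem abs_comp_nsmul_sub_le
    (hφL : ∀ y y' : EuclideanSpace ℝ d, |φ (proj y) - φ (proj y')| ≤ L * ‖y - y'‖) (n : ℕ)
    (y y' : EuclideanSpace ℝ d) :
    |φ (n • proj y) - φ (n • proj y')| ≤ L * n * ‖y - y'‖ := by
  rw [← proj_natCast_smul, ← proj_natCast_smul]
  refine (hφL _ _).trans_eq ?_
  rw [← smul_sub, norm_smul, Real.norm_natCast]
  ring

/-- `φ(n • ·)` is invariant under the lattice `(1/n)ℤ^d`: `n • proj(κ/n) = proj κ = 0`. [folklore] -/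
theorem comp_nsmul_add_proj_cellCorner (φ : UnitAddTorus d → F') {n : ℕ} (hn : 0 < n)
    (x : UnitAddTorus d) (κ : d → Fin n) :
    φ (n • (x + proj (cellCorner n κ))) = φ (n • x) := by
  have h : n • proj (cellCorner n κ) = (0 : UnitAddTorus d) := by
    rw [← proj_natCast_smul, cellCorner, smul_smul,
      mul_inv_cancel₀ (Nat.cast_ne_zero.2 hn.ne'), one_smul, proj_latticeVec]
  rw [smul_add, h, add_zero]

omit [Fintype d] [DecidableEq d] in
/-- `x ↦ φ(n • x)` is continuous for continuous `φ`. [folklore] -/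
theorem continuous_comp_nsmul {φ : UnitAddTorus d → F'} [TopologicalSpace F']
    (hφ : Continuous φ) (n : ℕ) : Continuous fun x : UnitAddTorus d => φ (n • x) :=
  hφ.comp (continuous_const_smul n)

end Rescale

/-! ## The nested products `P_k = ∏_{j ≤ k} φ(M_j ·)` -/

section Products

variable {φ : UnitAddTorus d → ℝ} {L : ℝ} {M : ℕ → ℕ}

omit [Fintype d] [DecidableEq d] in
/-- `P_k(x) ∈ [0,1]` when `φ` takes values in `[0,1]`. [folklore] -/
theorem prod_comp_nsmul_mem_Icc (h01 : ∀ x, φ x ∈ Icc (0 : ℝ) 1) (M : ℕ → ℕ) (k : ℕ)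
    (x : UnitAddTorus d) : ∏ j ∈ Finset.range (k + 1), φ (M j • x) ∈ Icc (0 : ℝ) 1 :=
  ⟨Finset.prod_nonneg fun _ _ => (h01 _).1,
    Finset.prod_le_one (fun _ _ => (h01 _).1) fun _ _ => (h01 _).2⟩

omit [Fintype d] [DecidableEq d] in
/-- `P_k` is continuous when `φ` is. [folklore] -/
theorem continuous_prod_comp_nsmul (hφ : Continuous φ) (M : ℕ → ℕ) (k : ℕ) :
    Continuous fun x : UnitAddTorus d => ∏ j ∈ Finset.range (k + 1), φ (M j • x) :=
  continuous_finsetProd _ fun j _ => continuous_comp_nsmul hφ (M j)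

/-- `|ab - a'b'| ≤ |a - a'| + |b - b'|` for `|a| ≤ 1`, `|b'| ≤ 1`. [folklore] -/
theorem abs_mul_sub_mul_le_of_abs_le_one {a a' b b' : ℝ} (ha : |a| ≤ 1) (hb' : |b'| ≤ 1) :
    |a * b - a' * b'| ≤ |a - a'| + |b - b'| := by
  have h : a * b - a' * b' = a * (b - b') + (a - a') * b' := by ring
  rw [h]
  refine (abs_add_le _ _).trans ?_
  rw [abs_mul, abs_mul]
  have h1 : |a| * |b - b'| ≤ |b - b'| := by
    calc |a| * |b - b'| ≤ 1 * |b - b'| := mul_le_mul_of_nonneg_right ha (abs_nonneg _)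
      _ = |b - b'| := one_mul _
  have h2 : |a - a'| * |b'| ≤ |a - a'| := by
    calc |a - a'| * |b'| ≤ |a - a'| * 1 := mul_le_mul_of_nonneg_left hb' (abs_nonneg _)
      _ = |a - a'| := mul_one _
  linarith

omit [DecidableEq d] in
/-- **The lift of `P_k` is `L ∑_{j≤k} M_j`-Lipschitz** (each factor `φ(M_j ·)` is `LM_j`-Lipschitz
with values in `[0,1]`; Lipschitz constants of products of `[0,1]`-valued functions add).
[cite: CoiculescuPalasek2025, proof of Lemma 3.3 ("`∑_{j=0}^{k-1} ‖φ_j‖_{C¹} ≤ ∑ C'M_j`")] -/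
theorem abs_prod_comp_nsmul_sub_le (h01 : ∀ x, φ x ∈ Icc (0 : ℝ) 1)
    (hφL : ∀ y y' : EuclideanSpace ℝ d, |φ (proj y) - φ (proj y')| ≤ L * ‖y - y'‖)
    (M : ℕ → ℕ) (k : ℕ) (y y' : EuclideanSpace ℝ d) :
    |∏ j ∈ Finset.range (k + 1), φ (M j • proj y) - ∏ j ∈ Finset.range (k + 1), φ (M j • proj y')| ≤
      L * (∑ j ∈ Finset.range (k + 1), (M j : ℝ)) * ‖y - y'‖ := by
  induction k with
  | zero =>
    simp only [zero_add, Finset.range_one, Finset.prod_singleton, Finset.sum_singleton]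
    exact abs_comp_nsmul_sub_le hφL (M 0) y y'
  | succ k ih =>
    rw [Finset.prod_range_succ (fun j => φ (M j • proj y)) (k + 1),
      Finset.prod_range_succ (fun j => φ (M j • proj y')) (k + 1),
      Finset.sum_range_succ (fun j => (M j : ℝ)) (k + 1)]
    have habs1 : |∏ j ∈ Finset.range (k + 1), φ (M j • proj y)| ≤ 1 := by
      have h := prod_comp_nsmul_mem_Icc h01 M k (proj y)
      rw [abs_of_nonneg h.1]
      exact h.2
    have habs2 : |φ (M (k + 1) • proj y')| ≤ 1 := by
      have h := h01 (M (k + 1) • proj y')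
      rw [abs_of_nonneg h.1]
      exact h.2
    have hfac := abs_comp_nsmul_sub_le hφL (M (k + 1)) y y'
    calc |(∏ j ∈ Finset.range (k + 1), φ (M j • proj y)) * φ (M (k + 1) • proj y) -
            (∏ j ∈ Finset.range (k + 1), φ (M j • proj y')) * φ (M (k + 1) • proj y')|
        ≤ |∏ j ∈ Finset.range (k + 1), φ (M j • proj y) -
              ∏ j ∈ Finset.range (k + 1), φ (M j • proj y')| +
            |φ (M (k + 1) • proj y) - φ (M (k + 1) • proj y')| :=
          abs_mul_sub_mul_le_of_abs_le_one habs1 habs2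
      _ ≤ L * (∑ j ∈ Finset.range (k + 1), (M j : ℝ)) * ‖y - y'‖ + L * (M (k + 1)) * ‖y - y'‖ :=
          add_le_add ih hfac
      _ = L * (∑ j ∈ Finset.range (k + 1), (M j : ℝ) + (M (k + 1) : ℝ)) * ‖y - y'‖ := by ring

end Products

/-! ## Real integrals as `lintegral`s of non-negative functions -/

section Lintegral

variable {X : Type*} [MeasurableSpace X] {μ : Measure X}

/-- For a non-negative integrable real function, `∫⁻ ‖h‖ₑ = ofReal (∫ h)`. [folklore] -/
theorem lintegral_enorm_eq_ofReal_integral {h : X → ℝ} (hint : Integrable h μ)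
    (h0 : ∀ x, 0 ≤ h x) : ∫⁻ x, ‖h x‖ₑ ∂μ = ENNReal.ofReal (∫ x, h x ∂μ) := by
  rw [ofReal_integral_eq_lintegral_ofReal hint (Eventually.of_forall h0)]
  exact lintegral_congr fun x => Real.enorm_eq_ofReal (h0 x)

end Lintegral

/-! ## The inductive step and the claim -/

section Claim

variable {φ : UnitAddTorus d → ℝ} {L : ℝ} {M : ℕ → ℕ}

/-- **The inductive step of Lemma 3.3**: for a cutoff `φ : T^d → [0,1]` with `L`-Lipschitz lift
and positive integer scales,
`∫ ∏_{j ≤ k+1} φ(M_j x) dx ≤ (∫ ∏_{j ≤ k} φ(M_j x) dx + L √d (∑_{j ≤ k} M_j) / M_{k+1}) · ∫ φ`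
— the improved Hölder inequality (Modena–Székelyhidi 2018, Lemma 2.1, at `p = 1`) with
`f = ∏_{j≤k} φ(M_j ·)` (`|f| ≤ 1`, lift `L∑M_j`-Lipschitz) and `g = φ(M_{k+1} ·)`, which is
`(1/M_{k+1})ℤ^d`-invariant with `∫ g = ∫ φ`.
[cite: CoiculescuPalasek2025, proof of Lemma 3.3 (the display after (claim))] -/
theorem integral_prod_comp_nsmul_succ_le (h01 : ∀ x, φ x ∈ Icc (0 : ℝ) 1)
    (hφL : ∀ y y' : EuclideanSpace ℝ d, |φ (proj y) - φ (proj y')| ≤ L * ‖y - y'‖) (hL : 0 ≤ L)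
    (hM : ∀ k, 0 < M k) (k : ℕ) :
    ∫ x, ∏ j ∈ Finset.range (k + 2), φ (M j • x) ≤
      ((∫ x, ∏ j ∈ Finset.range (k + 1), φ (M j • x)) +
          L * (∑ j ∈ Finset.range (k + 1), (M j : ℝ)) *
            (Real.sqrt (Fintype.card d) / M (k + 1))) * ∫ x, φ x := by
  have hφc : Continuous φ := continuous_of_lipschitz_lift hL hφL
  set P : UnitAddTorus d → ℝ := fun x => ∏ j ∈ Finset.range (k + 1), φ (M j • x) with hP
  set g : UnitAddTorus d → ℝ := fun x => φ (M (k + 1) • x) with hg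
  have hPc : Continuous P := continuous_prod_comp_nsmul hφc M k
  have hgc : Continuous g := continuous_comp_nsmul hφc (M (k + 1))
  have hP01 : ∀ x, P x ∈ Icc (0 : ℝ) 1 := fun x => prod_comp_nsmul_mem_Icc h01 M k x
  have hg01 : ∀ x, g x ∈ Icc (0 : ℝ) 1 := fun x => h01 _
  -- the improved Hölder inequality at `p = 1`
  have hS0 : 0 ≤ L * ∑ j ∈ Finset.range (k + 1), (M j : ℝ) :=
    mul_nonneg hL (Finset.sum_nonneg fun j _ => Nat.cast_nonneg _)
  have hIH := lintegral_rpow_smul_le_of_latticeInvariant (d := d) (N := M (k + 1)) (p := 1)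
    (M := 1) (L := L * ∑ j ∈ Finset.range (k + 1), (M j : ℝ)) (f := P) (g := g) (hM (k + 1))
    le_rfl hS0
    (fun x => by rw [abs_of_nonneg (hP01 x).1]; exact (hP01 x).2)
    (fun y y' => abs_prod_comp_nsmul_sub_le h01 hφL M k y y')
    hgc.aestronglyMeasurable
    (fun x κ => comp_nsmul_add_proj_cellCorner φ (hM (k + 1)) x κ)
  simp only [ENNReal.rpow_one, smul_eq_mul, sub_self, Real.rpow_zero, mul_one, one_mul] at hIH
  -- integrability and the identification `P · g = P_{k+1}`
  have hPg : ∀ x, P x * g x = ∏ j ∈ Finset.range (k + 2), φ (M j • x) := fun x =>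
    (Finset.prod_range_succ (fun j => φ (M j • x)) (k + 1)).symm
  have hPint : Integrable P volume := hPc.integrable_of_hasCompactSupport
    (HasCompactSupport.of_compactSpace _)
  have hgint : Integrable g volume := hgc.integrable_of_hasCompactSupport
    (HasCompactSupport.of_compactSpace _)
  have hPgint : Integrable (fun x => P x * g x) volume :=
    (hPc.mul hgc).integrable_of_hasCompactSupport (HasCompactSupport.of_compactSpace _)
  have hφint : Integrable φ volume := hφc.integrable_of_hasCompactSupport
    (HasCompactSupport.of_compactSpace _)
  have hPg0 : ∀ x, 0 ≤ P x * g x := fun x => mul_nonneg (hP01 x).1 (hg01 x).1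
  rw [lintegral_enorm_eq_ofReal_integral hPgint hPg0,
    lintegral_enorm_eq_ofReal_integral hPint (fun x => (hP01 x).1),
    lintegral_enorm_eq_ofReal_integral hgint (fun x => (hg01 x).1)] at hIH
  -- `∫ g = ∫ φ`
  have hgφ : ∫ x, g x = ∫ x, φ x := integral_comp_nsmul (hM (k + 1)) hφc.aestronglyMeasurable
  have hIP : 0 ≤ ∫ x, P x := integral_nonneg fun x => (hP01 x).1
  have hIφ : 0 ≤ ∫ x, φ x := integral_nonneg fun x => (h01 x).1
  have hC0 : 0 ≤ L * (∑ j ∈ Finset.range (k + 1), (M j : ℝ)) *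
      (Real.sqrt (Fintype.card d) / M (k + 1)) := by positivity
  rw [hgφ, ← ENNReal.ofReal_add hIP hC0, ← ENNReal.ofReal_mul (add_nonneg hIP hC0),
    ENNReal.ofReal_le_ofReal_iff (mul_nonneg (add_nonneg hIP hC0) hIφ)] at hIH
  calc ∫ x, ∏ j ∈ Finset.range (k + 2), φ (M j • x) = ∫ x, P x * g x :=
        integral_congr_ae (Eventually.of_forall fun x => (hPg x).symm)
    _ ≤ _ := hIH

/-- **Coiculescu–Palasek 2025, Lemma 3.3 (the claim `‖φ₀φ₁⋯φ_k‖_{L¹} ≤ (8δ)^k`), abstract form.**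
Let `φ : T^d → [0,1]` have `L`-Lipschitz lift and `∫ φ ≤ θ/2` with `θ ≤ 2`, and let the positive
integer scales satisfy the growth condition `L √d ∑_{j ≤ k} M_j ≤ θ^k M_{k+1}` for all `k`. Then
`∫ ∏_{j ≤ k} φ(M_j x) dx ≤ θ^k` for every `k` (induction: the step
`integral_prod_comp_nsmul_succ_le` gives `≤ (θ^k + θ^k) · θ/2 = θ^{k+1}`). In the paper `θ = 8δ`,
`∫ φ ≤ 4δ`, `δ = 1/20`, and the growth condition is "`O(C'kM_{k-1}M_k⁻¹) ≤ ½(8δ)^k`", arranged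
by taking `A` large. [cite: CoiculescuPalasek2025, Lemma 3.3 (proof, display (claim))] -/
theorem integral_prod_comp_nsmul_le_pow (h01 : ∀ x, φ x ∈ Icc (0 : ℝ) 1)
    (hφL : ∀ y y' : EuclideanSpace ℝ d, |φ (proj y) - φ (proj y')| ≤ L * ‖y - y'‖) (hL : 0 ≤ L)
    (hM : ∀ k, 0 < M k) {θ : ℝ} (hθ0 : 0 ≤ θ) (hθ2 : θ ≤ 2) (hφθ : ∫ x, φ x ≤ θ / 2)
    (hgrowth : ∀ k, L * Real.sqrt (Fintype.card d) * (∑ j ∈ Finset.range (k + 1), (M j : ℝ)) ≤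
      θ ^ k * M (k + 1))
    (k : ℕ) : ∫ x, ∏ j ∈ Finset.range (k + 1), φ (M j • x) ≤ θ ^ k := by
  have hφc : Continuous φ := continuous_of_lipschitz_lift hL hφL
  induction k with
  | zero =>
    simp only [zero_add, Finset.range_one, Finset.prod_singleton, pow_zero]
    rw [integral_comp_nsmul (hM 0) hφc.aestronglyMeasurable]
    linarith
  | succ k ih =>
    have hstep := integral_prod_comp_nsmul_succ_le h01 hφL hL hM k
    have hIφ : 0 ≤ ∫ x, φ x := integral_nonneg fun x => (h01 x).1
    have hMk : (0 : ℝ) < M (k + 1) := by exact_mod_cast hM (k + 1)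
    -- the growth condition: `L ∑M_j √d / M_{k+1} ≤ θ^k`
    have hG : L * (∑ j ∈ Finset.range (k + 1), (M j : ℝ)) *
        (Real.sqrt (Fintype.card d) / M (k + 1)) ≤ θ ^ k := by
      rw [← mul_div_assoc, div_le_iff₀ hMk]
      calc L * (∑ j ∈ Finset.range (k + 1), (M j : ℝ)) * Real.sqrt (Fintype.card d)
          = L * Real.sqrt (Fintype.card d) * ∑ j ∈ Finset.range (k + 1), (M j : ℝ) := by ring
        _ ≤ θ ^ k * M (k + 1) := hgrowth k
    calc ∫ x, ∏ j ∈ Finset.range (k + 1 + 1), φ (M j • x)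
        ≤ ((∫ x, ∏ j ∈ Finset.range (k + 1), φ (M j • x)) +
            L * (∑ j ∈ Finset.range (k + 1), (M j : ℝ)) *
              (Real.sqrt (Fintype.card d) / M (k + 1))) * ∫ x, φ x := hstep
      _ ≤ (θ ^ k + θ ^ k) * (θ / 2) := by
          refine mul_le_mul (add_le_add ih hG) hφθ hIφ ?_
          positivity
      _ = θ ^ (k + 1) := by ring

/-- **Lemma 3.3, first display, abstract form**: under the hypotheses of
`integral_prod_comp_nsmul_le_pow`, every measurable set on which the nested product
`∏_{j ≤ k} φ(M_j ·)` is identically `1` has Haar measure at most `θ^k` (in the paper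
`𝟙_{Ω̃_k} ≤ φ₀φ₁⋯φ_k ≤ 𝟙_{𝕋³}` pointwise, whence `|Ω̃_k| ≤ (8δ)^k|𝕋³| ≤ 2^{-k}|𝕋³|`).
[cite: CoiculescuPalasek2025, Lemma 3.3 (supportvolumeestimate)] -/
theorem measureReal_le_pow_of_prod_comp_nsmul_eq_one (h01 : ∀ x, φ x ∈ Icc (0 : ℝ) 1)
    (hφL : ∀ y y' : EuclideanSpace ℝ d, |φ (proj y) - φ (proj y')| ≤ L * ‖y - y'‖) (hL : 0 ≤ L)
    (hM : ∀ k, 0 < M k) {θ : ℝ} (hθ0 : 0 ≤ θ) (hθ2 : θ ≤ 2) (hφθ : ∫ x, φ x ≤ θ / 2)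
    (hgrowth : ∀ k, L * Real.sqrt (Fintype.card d) * (∑ j ∈ Finset.range (k + 1), (M j : ℝ)) ≤
      θ ^ k * M (k + 1))
    {Ω : Set (UnitAddTorus d)} (hΩ : MeasurableSet Ω) (k : ℕ)
    (hΩ1 : ∀ x ∈ Ω, ∏ j ∈ Finset.range (k + 1), φ (M j • x) = 1) :
    volume.real Ω ≤ θ ^ k := by
  have hφc : Continuous φ := continuous_of_lipschitz_lift hL hφL
  have hPc : Continuous fun x => ∏ j ∈ Finset.range (k + 1), φ (M j • x) :=
    continuous_prod_comp_nsmul hφc M k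
  have hPint : Integrable (fun x => ∏ j ∈ Finset.range (k + 1), φ (M j • x)) volume :=
    hPc.integrable_of_hasCompactSupport (HasCompactSupport.of_compactSpace _)
  calc volume.real Ω = ∫ x, Ω.indicator (1 : UnitAddTorus d → ℝ) x := (integral_indicator_one hΩ).symm
    _ ≤ ∫ x, ∏ j ∈ Finset.range (k + 1), φ (M j • x) := by
        refine integral_mono ((integrable_const 1).indicator hΩ) hPint fun x => ?_
        by_cases hx : x ∈ Ω
        · rw [indicator_of_mem hx, hΩ1 x hx, Pi.one_apply]
        · rw [indicator_of_notMem hx]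
          exact (prod_comp_nsmul_mem_Icc h01 M k x).1
    _ ≤ θ ^ k := integral_prod_comp_nsmul_le_pow h01 hφL hL hM hθ0 hθ2 hφθ hgrowth k

/-- For scales with `M_{k+1} ≥ 2 M_k` the partial sums are dominated by the last scale:
`∑_{j ≤ k} M_j ≤ 2 M_k` (so the growth condition of `integral_prod_comp_nsmul_le_pow` follows from
`2 L √d M_k ≤ θ^k M_{k+1}`, a condition on consecutive scales only — for the paper's
`M_k = ⌊A^{b^k}⌋`, `M_{k+1} ≳ M_k^b` with `b > 5`). [folklore] -/
theorem sum_range_natCast_le_two_mul_of_lacunary (hlac : ∀ k, 2 * M k ≤ M (k + 1)) (k : ℕ) :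
    ∑ j ∈ Finset.range (k + 1), (M j : ℝ) ≤ 2 * M k := by
  induction k with
  | zero =>
    simp only [zero_add, Finset.range_one, Finset.sum_singleton]
    have h0 : (0 : ℝ) ≤ M 0 := Nat.cast_nonneg _
    linarith
  | succ k ih =>
    rw [Finset.sum_range_succ (fun j => (M j : ℝ)) (k + 1)]
    have h : (2 : ℝ) * M k ≤ M (k + 1) := by exact_mod_cast hlac k
    linarith

/-- **Lemma 3.3 for lacunary scales**: with `M_{k+1} ≥ 2M_k` and the consecutive-scale condition
`2 L √d M_k ≤ θ^k M_{k+1}`, `∫ ∏_{j ≤ k} φ(M_j x) dx ≤ θ^k`.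
[cite: CoiculescuPalasek2025, Lemma 3.3 (proof)] -/
theorem integral_prod_comp_nsmul_le_pow_of_lacunary (h01 : ∀ x, φ x ∈ Icc (0 : ℝ) 1)
    (hφL : ∀ y y' : EuclideanSpace ℝ d, |φ (proj y) - φ (proj y')| ≤ L * ‖y - y'‖) (hL : 0 ≤ L)
    (hM : ∀ k, 0 < M k) (hlac : ∀ k, 2 * M k ≤ M (k + 1)) {θ : ℝ} (hθ0 : 0 ≤ θ) (hθ2 : θ ≤ 2)
    (hφθ : ∫ x, φ x ≤ θ / 2)
    (hgrowth : ∀ k, 2 * L * Real.sqrt (Fintype.card d) * M k ≤ θ ^ k * M (k + 1)) (k : ℕ) :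
    ∫ x, ∏ j ∈ Finset.range (k + 1), φ (M j • x) ≤ θ ^ k := by
  refine integral_prod_comp_nsmul_le_pow h01 hφL hL hM hθ0 hθ2 hφθ (fun k => ?_) k
  have h1 := sum_range_natCast_le_two_mul_of_lacunary hlac k
  have h2 : 0 ≤ L * Real.sqrt (Fintype.card d) := by positivity
  calc L * Real.sqrt (Fintype.card d) * ∑ j ∈ Finset.range (k + 1), (M j : ℝ)
      ≤ L * Real.sqrt (Fintype.card d) * (2 * M k) := mul_le_mul_of_nonneg_left h1 h2
    _ = 2 * L * Real.sqrt (Fintype.card d) * M k := by ring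
    _ ≤ θ ^ k * M (k + 1) := hgrowth k

end Claim

end Literature.Analysis.FluidPDE
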